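import Summits.Ventures.CertifiedArithmetic.LowPrec.SRSaturationFormats
import Summits.Ventures.CertifiedArithmetic.LowPrec.SRTreeIntervalsExp
import HarnessLib

/-!
# Stochastic rounding XIV — a DATA-ADAPTIVE saturation certificate: per-node headroom and
per-node interval variances (files XII–XIII meet the interval certificates of file IX′)

HONEST FRAMING: certified error envelopes and provably optimal rounding/accumulation schemes for
low-precision formats under stated cost models; every table by two implementations; no hardware or
vendor claims.

File XIII bounds the saturation probability of SR summation along a tree `T` by
`Σ_v 2e^{−2h²/(m_v G²)}` with ONE headroom `h` and ONE gap bound `G` (the top-binade spacing). Both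
are worst cases: a node deep in the tree whose exact partial sum `s_v` is far from the range ends has
headroom `d_v = min(s_v − lo, hi − s_v) ≫ h`, and the randomness below it has variance proxy
`Σ_{u<v} w_u²` with the NODE-LOCAL spacings `w_u` of the interval certificate (`SRTreeIntervalsExp.wI`,
valid on every branch with no hypothesis) instead of `m_v G²`. This file proves the adaptive form

  `P_F(saturation along T) ≤ satBoundI F' lo hi T = Σ_v nodeBoundS (4(envI F' l_v + envI F' r_v)) d_v`,
  `nodeBoundS S d = [S ≠ 0] · 2e^{−2d²/S}`,

for every finite `F ⊂ ℚ` with `HullData F lo hi G`, `F' = extendBy F lo hi G (m − 1)` its uniform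
refinement, under the sole hypothesis that every exact partial sum lies strictly inside `(lo, hi)`
(`HeadroomT lo hi h T` for some `h > 0`, which only certifies `d_v > 0`). `envI F' ·` is the
kernel-computable rational interval envelope of file IX′ (range propagation, cost `O(m·|F|)`), so the
certificate is a sum of `m` explicit exponentials of rationals. Consequences, again with no hypothesis on
the rounding path: tails `≤ 2e^{−t²/(2 envI F' T)} + satBoundI`, bias `≤ 2R·satBoundI`, mean square
`≤ envI F' T + R²·satBoundI`. The uniform theorem of file XIII is the special case `w ≡ G`, `d_v ≥ h`
(`satBoundW_const_le_satBoundT`).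

## Main statements
* `satProb_le_satBoundW` — over `ℝ`, generic node weights `w` with `GapLEW F w T`:
  `Σ_nodes P(exit) ≤ satBoundW w lo hi T`.
* `satBoundW_const_le_satBoundT` — uniform weights recover (and are dominated via) file XII's bound.
* `satBoundW_wI_cast` — with the interval weights the bound is `satBoundI` of the rational data.
* `satProbT_le_satBoundI`, `prob_dev_ge_le_I`, `abs_treeBias_le_I`, `sq_err_le_I` — the four
  hypothesis-free statements for `F ⊂ ℚ`; `format_satProbT_le_I` — every minifloat format.
-/

namespace Summit.Ventures.CertifiedArithmetic.LowPrec.SR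

open Literature.ComputerArithmetic.ConnollyHighamMary2021 Literature.ComputerArithmetic.FloatingPoint
open Finset Real STree

/-! ### The node term and the adaptive bound -/

/-- A node's own headroom: the distance of its exact partial sum `s` to the nearer end of `[lo, hi]`. -/
def room {K : Type*} [Field K] [LinearOrder K] (lo hi s : K) : K := min (s - lo) (hi - s)

/-- `nodeBoundS S d = 2e^{−2d²/S}` for a variance proxy `S ≠ 0`, and `0` when `S = 0` (no randomness
below the node: its pre-rounding value is the exact partial sum). -/
noncomputable def nodeBoundS (S d : ℝ) : ℝ := if S = 0 then 0 else 2 * exp (-2 * d ^ 2 / S)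

/-- **The adaptive bound**: `satBoundW w lo hi T = Σ_{internal v = (l, r)} nodeBoundS (Σw²(l) + Σw²(r)) d_v`
with `d_v = room lo hi s_v`. -/
noncomputable def satBoundW (w : STree ℝ → ℝ) (lo hi : ℝ) : STree ℝ → ℝ
  | .leaf _ => 0
  | .node l r => satBoundW w lo hi l + satBoundW w lo hi r
      + nodeBoundS (sumSqW w l + sumSqW w r) (room lo hi (l.exact + r.exact))

/-! ### One node: weighted pair mgf, Chernoff, and the deterministic case -/

/-- **Weighted pair mgf.** Independent subtrees with weighted gap certificates:
`E_l E_r e^{θ(ŝ_l + ŝ_r − s_l − s_r)} ≤ e^{θ² Σw²(l)/8} · e^{θ² Σw²(r)/8}`. -/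
theorem pair_exp_le_W (F : Finset ℝ) (w : STree ℝ → ℝ) (θ : ℝ) (l r : STree ℝ) (hl : NoSatT F l)
    (hr : NoSatT F r) (hgl : GapLEW F w l) (hgr : GapLEW F w r) :
    treeExp F l (fun a => treeExp F r (fun b => exp (θ * (a + b - (l.exact + r.exact)))))
      ≤ exp (θ ^ 2 * sumSqW w l / 8) * exp (θ ^ 2 * sumSqW w r / 8) := by
  have ihl := treeExp_exp_le_W F w θ l hl hgl
  have ihr := treeExp_exp_le_W F w θ r hr hgr
  set Br := exp (θ ^ 2 * sumSqW w r / 8) with hBr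
  have hB : ∀ a, treeExp F r (fun b => exp (θ * (a + b - (l.exact + r.exact))))
      = exp (θ * (a - l.exact)) * treeExp F r (fun b => exp (θ * (b - r.exact))) := by
    intro a
    rw [← treeExp_mul_left]
    refine treeExp_congr F r (fun b => ?_)
    rw [← exp_add]; congr 1; ring
  rw [treeExp_congr F l hB]
  calc treeExp F l (fun a => exp (θ * (a - l.exact)) * treeExp F r (fun b => exp (θ * (b - r.exact))))
      ≤ treeExp F l (fun a => Br * exp (θ * (a - l.exact))) :=
        treeExp_mono F l (fun a => by
          rw [mul_comm]; exact mul_le_mul_of_nonneg_right ihr (exp_pos _).le)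
    _ = Br * treeExp F l (fun a => exp (θ * (a - l.exact))) := treeExp_mul_left F l _ _
    _ ≤ Br * exp (θ ^ 2 * sumSqW w l / 8) := mul_le_mul_of_nonneg_left ihl (exp_pos _).le
    _ = _ := mul_comm _ _

/-- No variance below a subtree (`Σw² = 0` with the weighted gap certificate) means its value never
deviates by `t > 0` from its exact sum. -/
theorem prob_dev_eq_zero_of_sumSqW (F : Finset ℝ) (w : STree ℝ → ℝ) (T : STree ℝ) (h : NoSatT F T)
    (hg : GapLEW F w T) (h0 : sumSqW w T = 0) {t : ℝ} (ht : 0 < t) :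
    treeExp F T (devInd t T.exact) ≤ 0 := by
  have h1 := tree_prob_dev_ge_le_treeVar F T h ht
  have h2 := treeVar_le_sumSqW F w T hg
  rw [h0, zero_div] at h2
  have : treeVar F T / t ^ 2 ≤ 0 := div_nonpos_of_nonpos_of_nonneg h2 (by positivity)
  linarith

/-- If both children are within `d/2` of their exact sums, the node's pre-rounding value is in the
window: `outInd ≤ 𝟙{|ŝ_l − s_l| ≥ d/2} + 𝟙{|ŝ_r − s_r| ≥ d/2}`. -/
theorem outInd_le_devInd_halves (H : Finset ℝ) {lo hi d sl sr : ℝ}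
    (hH : ∀ c, lo ≤ c → c ≤ hi → InHull H c) (h1 : lo + d ≤ sl + sr) (h2 : sl + sr ≤ hi - d)
    (a b : ℝ) : outInd H (a + b) ≤ devInd (d / 2) sl a + devInd (d / 2) sr b := by
  unfold outInd devInd
  by_cases ha : d / 2 ≤ |a - sl|
  · rw [if_pos ha]; split_ifs <;> norm_num
  · by_cases hb : d / 2 ≤ |b - sr|
    · rw [if_pos hb]; split_ifs <;> norm_num
    · rw [if_neg ha, if_neg hb]
      rw [not_le] at ha hb
      have ha' := abs_lt.mp ha
      have hb' := abs_lt.mp hb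
      rw [if_pos (hH _ (by linarith [ha'.1, hb'.1]) (by linarith [ha'.2, hb'.2]))]; norm_num

/-- **One node, adaptive.** Under no saturation and weighted gap certificates in both subtrees and the
exact partial sum at distance `≥ d > 0` from the ends of `[lo, hi] ⊆ hull H`:
`P(ŝ_l + ŝ_r ∉ hull H) ≤ nodeBoundS (Σw²(l) + Σw²(r)) d`. -/
theorem node_outProb_le_W (F H : Finset ℝ) (w : STree ℝ → ℝ) {lo hi d : ℝ} (hd : 0 < d)
    (hH : ∀ c, lo ≤ c → c ≤ hi → InHull H c) (l r : STree ℝ) (hl : NoSatT F l) (hr : NoSatT F r)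
    (hgl : GapLEW F w l) (hgr : GapLEW F w r) (h1 : lo + d ≤ l.exact + r.exact)
    (h2 : l.exact + r.exact ≤ hi - d) :
    treeExp F l (fun a => treeExp F r (fun b => outInd H (a + b)))
      ≤ nodeBoundS (sumSqW w l + sumSqW w r) d := by
  set s := l.exact + r.exact with hs
  set S := sumSqW w l + sumSqW w r with hS
  unfold nodeBoundS
  split_ifs with hS0
  · -- no randomness below: both children are surely exact (Chebyshev with a zero variance bound)
    have hl0 : sumSqW w l = 0 := by
      have := sumSqW_nonneg w l; have := sumSqW_nonneg w r; linarith
    have hr0 : sumSqW w r = 0 := by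
      have := sumSqW_nonneg w l; have := sumSqW_nonneg w r; linarith
    have hd2 : 0 < d / 2 := by positivity
    calc treeExp F l (fun a => treeExp F r (fun b => outInd H (a + b)))
        ≤ treeExp F l (fun a => treeExp F r (fun b =>
            devInd (d / 2) l.exact a + devInd (d / 2) r.exact b)) :=
          treeExp_mono F l (fun a => treeExp_mono F r (fun b =>
            outInd_le_devInd_halves H hH h1 h2 a b))
      _ = treeExp F l (devInd (d / 2) l.exact) + treeExp F r (devInd (d / 2) r.exact) := by
          have hin : ∀ a, treeExp F r (fun b => devInd (d / 2) l.exact a + devInd (d / 2) r.exact b)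
              = devInd (d / 2) l.exact a + treeExp F r (devInd (d / 2) r.exact) := by
            intro a
            rw [treeExp_add F r (fun _ => devInd (d / 2) l.exact a) (devInd (d / 2) r.exact),
              treeExp_const]
          rw [treeExp_congr F l hin, treeExp_add_const]
      _ ≤ 0 := by
          have := prob_dev_eq_zero_of_sumSqW F w l hl hgl hl0 hd2
          have := prob_dev_eq_zero_of_sumSqW F w r hr hgr hr0 hd2
          linarith
  -- pointwise Chernoff, then the weighted pair mgf with `±θ`, `θ = 4d/S`
  have hpt : ∀ a b, outInd H (a + b) ≤ upDevInd d s (a + b) + dnDevInd d s (a + b) :=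
    fun a b => outInd_le_devInds H hH h1 h2 (a + b)
  have hsplit : treeExp F l (fun a => treeExp F r (fun b => outInd H (a + b)))
      ≤ treeExp F l (fun a => treeExp F r (fun b => upDevInd d s (a + b)))
        + treeExp F l (fun a => treeExp F r (fun b => dnDevInd d s (a + b))) := by
    rw [← treeExp_add]
    refine treeExp_mono F l (fun a => ?_)
    rw [← treeExp_add]
    exact treeExp_mono F r (fun b => hpt a b)
  have hSpos : 0 < S := lt_of_le_of_ne (by positivity [sumSqW_nonneg w l, sumSqW_nonneg w r]) (Ne.symm hS0)
  set θ := 4 * d / S with hθ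
  have hθ0 : 0 ≤ θ := by positivity
  have hup : treeExp F l (fun a => treeExp F r (fun b => upDevInd d s (a + b)))
      ≤ exp (-(θ * d)) * (exp (θ ^ 2 * sumSqW w l / 8) * exp (θ ^ 2 * sumSqW w r / 8)) := by
    calc treeExp F l (fun a => treeExp F r (fun b => upDevInd d s (a + b)))
        ≤ treeExp F l (fun a => treeExp F r (fun b =>
            exp (-(θ * d)) * exp (θ * (a + b - (l.exact + r.exact))))) :=
          treeExp_mono F l (fun a => treeExp_mono F r (fun b => upDevInd_le_exp d s (a + b) hθ0))
      _ = exp (-(θ * d)) * treeExp F l (fun a => treeExp F r (fun b =>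
            exp (θ * (a + b - (l.exact + r.exact))))) := by
          rw [← treeExp_mul_left]
          exact treeExp_congr F l (fun a => treeExp_mul_left F r _ _)
      _ ≤ _ := mul_le_mul_of_nonneg_left (pair_exp_le_W F w θ l r hl hr hgl hgr) (exp_pos _).le
  have hdn : treeExp F l (fun a => treeExp F r (fun b => dnDevInd d s (a + b)))
      ≤ exp (-(θ * d)) * (exp (θ ^ 2 * sumSqW w l / 8) * exp (θ ^ 2 * sumSqW w r / 8)) := by
    calc treeExp F l (fun a => treeExp F r (fun b => dnDevInd d s (a + b)))
        ≤ treeExp F l (fun a => treeExp F r (fun b =>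
            exp (-(θ * d)) * exp ((-θ) * (a + b - (l.exact + r.exact))))) :=
          treeExp_mono F l (fun a => treeExp_mono F r (fun b => dnDevInd_le_exp d s (a + b) hθ0))
      _ = exp (-(θ * d)) * treeExp F l (fun a => treeExp F r (fun b =>
            exp ((-θ) * (a + b - (l.exact + r.exact))))) := by
          rw [← treeExp_mul_left]
          exact treeExp_congr F l (fun a => treeExp_mul_left F r _ _)
      _ ≤ _ := by
          refine mul_le_mul_of_nonneg_left ?_ (exp_pos _).le
          have := pair_exp_le_W F w (-θ) l r hl hr hgl hgr
          rwa [neg_sq] at this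
  have key : exp (-(θ * d)) * (exp (θ ^ 2 * sumSqW w l / 8) * exp (θ ^ 2 * sumSqW w r / 8))
      = exp (-2 * d ^ 2 / S) := by
    rw [← exp_add, ← exp_add]; congr 1
    rw [hθ, hS]; field_simp; ring
  rw [key] at hup hdn
  linarith

/-! ### The tree -/

/-- **Σ_nodes P(exit) ≤ satBoundW.** If `F` does not saturate along `T`, `GapLEW F w T`, the data has
headroom `h > 0` in `[lo, hi] ⊆ hull H` (only `d_v ≥ h > 0` is used — each node enters with its OWN
headroom `d_v`), then `satProb F H T ≤ satBoundW w lo hi T`. -/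
theorem satProb_le_satBoundW (F H : Finset ℝ) (w : STree ℝ → ℝ) {lo hi h : ℝ} (hh : 0 < h)
    (hH : ∀ c, lo ≤ c → c ≤ hi → InHull H c) :
    ∀ T : STree ℝ, NoSatT F T → GapLEW F w T → HeadroomT lo hi h T →
      satProb F H T ≤ satBoundW w lo hi T
  | .leaf _, _, _, _ => le_rfl
  | .node l r, ⟨hl, hr, _⟩, ⟨hgl, hgr, _⟩, ⟨hTl, hTr, h1, h2⟩ => by
      simp only [satProb, satBoundW]
      have ihl := satProb_le_satBoundW F H w hh hH l hl hgl hTl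
      have ihr := satProb_le_satBoundW F H w hh hH r hr hgr hTr
      have hd : 0 < room lo hi (l.exact + r.exact) := by
        unfold room; exact lt_min (by linarith) (by linarith)
      have hn := node_outProb_le_W F H w hd hH l r hl hr hgl hgr
        (by unfold room; linarith [min_le_left (l.exact + r.exact - lo) (hi - (l.exact + r.exact))])
        (by unfold room; linarith [min_le_right (l.exact + r.exact - lo) (hi - (l.exact + r.exact))])
      linarith

/-- **Uniform weights are the special case of file XII**: with `w ≡ G` and headroom `h`,
`satBoundW (fun _ => G) lo hi T ≤ satBoundT G h T`. -/
theorem satBoundW_const_le_satBoundT (G : ℝ) {lo hi h : ℝ} (hh : 0 ≤ h) :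
    ∀ T : STree ℝ, HeadroomT lo hi h T → satBoundW (fun _ => G) lo hi T ≤ satBoundT G h T
  | .leaf _, _ => le_rfl
  | .node l r, ⟨hTl, hTr, h1, h2⟩ => by
      simp only [satBoundW, satBoundT]
      have ihl := satBoundW_const_le_satBoundT G hh l hTl
      have ihr := satBoundW_const_le_satBoundT G hh r hTr
      have hn : nodeBoundS (sumSqW (fun _ => G) l + sumSqW (fun _ => G) r) (room lo hi (l.exact + r.exact))
          ≤ nodeBound G h (l.nodes + r.nodes) := by
        rw [sumSqW_const, sumSqW_const]
        have hd : h ≤ room lo hi (l.exact + r.exact) := by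
          unfold room; exact le_min (by linarith) (by linarith)
        unfold nodeBoundS nodeBound
        by_cases hm : l.nodes + r.nodes = 0
        · have : (l.nodes : ℝ) * G ^ 2 + r.nodes * G ^ 2 = 0 := by
            have hl0 : l.nodes = 0 := by omega
            have hr0 : r.nodes = 0 := by omega
            rw [hl0, hr0]; push_cast; ring
          rw [if_pos this, if_pos hm]
        · rw [if_neg hm]
          split_ifs with hS
          · positivity
          · have hS' : (l.nodes : ℝ) * G ^ 2 + r.nodes * G ^ 2 = ((l.nodes + r.nodes : ℕ) : ℝ) * G ^ 2 := by
              push_cast; ring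
            have hSpos : 0 < ((l.nodes + r.nodes : ℕ) : ℝ) * G ^ 2 := by
              rw [← hS']; exact lt_of_le_of_ne (by positivity) (Ne.symm hS)
            rw [hS']
            refine mul_le_mul_of_nonneg_left (exp_le_exp.mpr ?_) (by norm_num)
            rw [div_le_div_iff_of_pos_right hSpos]
            nlinarith [mul_self_le_mul_self hh hd]
      linarith

/-! ### Rational data: the interval weights, transported -/

/-- The adaptive certificate of rational data: node term
`nodeBoundS (4(envI F' l + envI F' r)) (room lo hi s_v)` — `m` exponentials of rationals. -/
noncomputable def satBoundI (F' : Finset ℚ) (lo hi : ℚ) : STree ℚ → ℝ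
  | .leaf _ => 0
  | .node l r => satBoundI F' lo hi l + satBoundI F' lo hi r
      + nodeBoundS (((4 * (envI F' l + envI F' r) : ℚ) : ℝ))
          (((room lo hi (l.exact + r.exact) : ℚ) : ℝ))

/-- With the interval weights of the cast value set, `satBoundW` IS `satBoundI` of the rational data. -/
theorem satBoundW_wI_cast (F' : Finset ℚ) (lo hi : ℚ) : ∀ T : STree ℚ,
    satBoundW (wI (realImage F')) (lo : ℝ) hi (T.map ((↑) : ℚ → ℝ)) = satBoundI F' lo hi T
  | .leaf _ => rfl
  | .node l r => by
      simp only [STree.map, satBoundW, satBoundI]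
      rw [satBoundW_wI_cast F' lo hi l, satBoundW_wI_cast F' lo hi r, sumSqW_wI, sumSqW_wI,
        envI_cast, envI_cast, exact_map_cast, exact_map_cast]
      congr 2
      · push_cast; ring
      · unfold room; push_cast; rfl

/-- **P(SATURATION), ADAPTIVE FORM.** For `F ⊂ ℚ` with `HullData F lo hi G` and every exact partial
sum strictly inside `(lo, hi)` (headroom `h > 0`):
`P_F(SR summation of T saturates) ≤ satBoundI (extendBy F lo hi G (m − 1)) lo hi T`. -/
theorem satProbT_le_satBoundI {F : Finset ℚ} {lo hi G : ℚ} (hB : HullData F lo hi G) {h : ℚ}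
    (hh : 0 < h) (T : STree ℚ) (hT : HeadroomT lo hi h T) :
    ((satProbT F T : ℚ) : ℝ) ≤ satBoundI (extendBy F lo hi G (T.nodes - 1)) lo hi T := by
  set F' := extendBy F lo hi G (T.nodes - 1) with hF'
  have hne : F'.Nonempty := ⟨lo, subset_extendBy F lo hi G _ hB.lo_mem⟩
  obtain ⟨hns, _⟩ := hB.refine hh.le (N := T.nodes - 1) (T := T) (by omega) hT
  have h1 : satProbT F T ≤ satProb F' F T :=
    satProbT_le_satProb (agrees_extendBy F hB.gap_pos hB.bounds _) T
  have h2 : ((satProb F' F T : ℚ) : ℝ) ≤ satBoundI F' lo hi T := by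
    rw [← satProb_cast, ← satBoundW_wI_cast F' lo hi T]
    refine satProb_le_satBoundW (realImage F') (realImage F) (wI (realImage F')) (lo := (lo : ℝ))
      (hi := (hi : ℝ)) (h := (h : ℝ)) (by exact_mod_cast hh) ?_ _ ((noSatT_cast F' T).mpr hns)
      (gapLEW_wI (realImage_nonempty.mpr hne) _) ((headroomT_cast lo hi h T).mpr hT)
    intro c hc1 hc2
    exact ⟨⟨(lo : ℝ), cast_mem_realImage.mpr hB.lo_mem, hc1⟩,
      ⟨(hi : ℝ), cast_mem_realImage.mpr hB.hi_mem, hc2⟩⟩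
  calc ((satProbT F T : ℚ) : ℝ) ≤ ((satProb F' F T : ℚ) : ℝ) := by exact_mod_cast h1
    _ ≤ _ := h2

/-- **TAILS, ADAPTIVE FORM**: `P_F(|ŝ_T − ∑| ≥ t) ≤ 2e^{−t²/(2·envI F' T)} + satBoundI F' lo hi T`. -/
theorem prob_dev_ge_le_I {F : Finset ℚ} {lo hi G : ℚ} (hB : HullData F lo hi G) {h : ℚ}
    (hh : 0 < h) (T : STree ℚ) (hT : HeadroomT lo hi h T) (t : ℚ) (ht : 0 < t) :
    ((treeExp F T (devInd t T.exact) : ℚ) : ℝ)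
      ≤ 2 * exp (-(t : ℝ) ^ 2 / (2 * ((envI (extendBy F lo hi G (T.nodes - 1)) T : ℚ) : ℝ)))
        + satBoundI (extendBy F lo hi G (T.nodes - 1)) lo hi T := by
  set F' := extendBy F lo hi G (T.nodes - 1) with hF'
  have hne : F'.Nonempty := ⟨lo, subset_extendBy F lo hi G _ hB.lo_mem⟩
  obtain ⟨hns, _⟩ := hB.refine hh.le (N := T.nodes - 1) (T := T) (by omega) hT
  have hf : ∀ v, 0 ≤ devInd t T.exact v ∧ devInd t T.exact v ≤ 1 := fun v => by
    unfold devInd; split_ifs <;> norm_num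
  have h1 := treeExp_le_add_satProbT (agrees_extendBy F hB.gap_pos hB.bounds (T.nodes - 1)) T hf
  have h2 := tree_prob_dev_ge_le_exp_I_rat hne T hns t ht
  have h3 := satProbT_le_satBoundI hB hh T hT
  calc ((treeExp F T (devInd t T.exact) : ℚ) : ℝ)
      ≤ ((treeExp F' T (devInd t T.exact) : ℚ) : ℝ) + ((satProbT F T : ℚ) : ℝ) := by
        exact_mod_cast h1
    _ ≤ _ := add_le_add h2 h3

/-- **BIAS, ADAPTIVE FORM**: `|E_F ŝ_T − ∑| ≤ 2R · satBoundI`, `R = max(hi − lo, mG)`. -/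
theorem abs_treeBias_le_I {F : Finset ℚ} {lo hi G : ℚ} (hB : HullData F lo hi G) {h : ℚ}
    (hh : 0 < h) (T : STree ℚ) (hT : HeadroomT lo hi h T) :
    ((|treeBias F T| : ℚ) : ℝ) ≤ 2 * ((max (hi - lo) (T.nodes * G) : ℚ) : ℝ)
      * satBoundI (extendBy F lo hi G (T.nodes - 1)) lo hi T := by
  have h1 := hB.bias_le hh.le T hT
  have h2 := satProbT_le_satBoundI hB hh T hT
  have hR : (0 : ℝ) ≤ 2 * ((max (hi - lo) (T.nodes * G) : ℚ) : ℝ) := by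
    have : (0 : ℚ) ≤ max (hi - lo) (T.nodes * G) :=
      le_max_of_le_right (mul_nonneg (Nat.cast_nonneg _) hB.gap_pos.le)
    positivity
  calc ((|treeBias F T| : ℚ) : ℝ)
      ≤ ((2 * max (hi - lo) (T.nodes * G) * satProbT F T : ℚ) : ℝ) := by exact_mod_cast h1
    _ = 2 * ((max (hi - lo) (T.nodes * G) : ℚ) : ℝ) * ((satProbT F T : ℚ) : ℝ) := by push_cast; ring
    _ ≤ _ := mul_le_mul_of_nonneg_left h2 hR

/-- **MEAN SQUARE, ADAPTIVE FORM**: `E_F(ŝ_T − ∑)² ≤ envI F' T + R² · satBoundI`. -/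
theorem sq_err_le_I {F : Finset ℚ} {lo hi G : ℚ} (hB : HullData F lo hi G) {h : ℚ}
    (hh : 0 < h) (T : STree ℚ) (hT : HeadroomT lo hi h T) :
    ((treeExp F T (fun v => (v - T.exact) ^ 2) : ℚ) : ℝ)
      ≤ ((envI (extendBy F lo hi G (T.nodes - 1)) T : ℚ) : ℝ)
        + ((max (hi - lo) (T.nodes * G) : ℚ) : ℝ) ^ 2
          * satBoundI (extendBy F lo hi G (T.nodes - 1)) lo hi T := by
  set F' := extendBy F lo hi G (T.nodes - 1) with hF'
  have hne : F'.Nonempty := ⟨lo, subset_extendBy F lo hi G _ hB.lo_mem⟩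
  obtain ⟨hns, _⟩ := hB.refine hh.le (N := T.nodes - 1) (T := T) (by omega) hT
  obtain ⟨hF, hF2⟩ := hB.allOut_both hh.le (N := T.nodes - 1) (by omega) hT
  have h1 := abs_sq_sub_treeVar_le (agrees_extendBy F hB.gap_pos hB.bounds _) T hF hF2 hns
  have hv : treeVar F' T ≤ envI F' T := treeVar_le_envI hne T
  have h2 := satProbT_le_satBoundI hB hh T hT
  have hR : (0 : ℝ) ≤ ((max (hi - lo) (T.nodes * G) : ℚ) : ℝ) ^ 2 := sq_nonneg _
  have h3 : treeExp F T (fun v => (v - T.exact) ^ 2)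
      ≤ envI F' T + max (hi - lo) (T.nodes * G) ^ 2 * satProbT F T := by
    have := (abs_le.mp h1).2; linarith
  calc ((treeExp F T (fun v => (v - T.exact) ^ 2) : ℚ) : ℝ)
      ≤ ((envI F' T + max (hi - lo) (T.nodes * G) ^ 2 * satProbT F T : ℚ) : ℝ) := by
        exact_mod_cast h3
    _ = ((envI F' T : ℚ) : ℝ)
        + ((max (hi - lo) (T.nodes * G) : ℚ) : ℝ) ^ 2 * ((satProbT F T : ℚ) : ℝ) := by
        push_cast; ring
    _ ≤ _ := by nlinarith

/-- **Every minifloat format, adaptive form**: for SR summation of `T` in `valueSet φ` with all exact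
partial sums strictly inside `(−maxRat, maxRat)`,
`P(saturation) ≤ satBoundI (extendBy (valueSet φ) (−maxRat) maxRat (topGap φ) (m − 1)) (−maxRat) maxRat T`. -/
theorem format_satProbT_le_I (φ : Format) {h : ℚ} (hh : 0 < h) (T : STree ℚ)
    (hT : HeadroomT (-φ.maxRat) φ.maxRat h T) :
    ((satProbT (MiniFloat.valueSet φ) T : ℚ) : ℝ)
      ≤ satBoundI (extendBy (MiniFloat.valueSet φ) (-φ.maxRat) φ.maxRat (topGap φ) (T.nodes - 1))
          (-φ.maxRat) φ.maxRat T :=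
  satProbT_le_satBoundI (hullData_valueSet φ) hh T hT

end Summit.Ventures.CertifiedArithmetic.LowPrec.SR
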